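import Mathlib
import Literature.Analysis.FluidPDE.FluidComputerGadget
import HarnessLib

/-!
# The fluid-computer gadget interface, III: ONE-SHOT DEGENERACY of the interface as typed

HONEST FRAMING: low prior, high value-of-information experiment on Tao's machine paradigm;
NOT a claim that NS blows up.

(Cell `pub-fluidc`, blueprint seat bp2, gen 5; answers seat bp3's gen-4 ask (b) "confirm the classical
twin of the one-shot degeneracy". Companion prose: `SPEC-SHEET.md` v0.5 §4, `ASSEMBLY.md` v3 §2e.)

`FluidComputerGadget.lean` defines a GADGET LIBRARY `GadgetLibrary ν σ` (a cascade of energy-transfer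
gadgets meeting the uniform specification `σ`) and proves that a library with valid, closing,
super-threshold specs admits no global regular solution from its seed
(`GadgetLibrary.no_global_regular_solution`; summit side `¬ NavierStokesRegularity`). This file records,
kernel-checked, the observation that the interface AS TYPED has no content beyond that conclusion:

* `oneShotLibrary` — from ANY Clay-class datum `v` (smooth, divergence free, rapidly decaying),
  non-zero at one point, that has NO global regular solution, and ANY valid spec `σ`, a
  `GadgetLibrary ν σ` is built whose seed is `v`, whose level-`0` input class is `{v}` and whose
  higher input classes are EMPTY: the step hypothesis `step` quantifies over GLOBAL regular solutions
  passing through an input class at some time `t ≥ 0`, and by time translation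
  (`isNavierStokesSolution_timeShift`) no global regular solution ever passes through `v`, so `step`
  holds vacuously; the concentration floor holds at the one point where `v ≠ 0`; transfer times are `0`.
* `nonempty_gadgetLibrary_iff` — consequently, for valid closing super-threshold specs,
  `Nonempty (GadgetLibrary ν σ) ↔ ∃ v, Clay-class v ∧ NoGlobalRegularSolution ν v`: the existence of a
  library is EXACTLY calibrated to the failure of global regularity for one datum at viscosity `ν`
  (summit side: `¬ NavierStokesRegularity ↔ ∃ ν > 0, ∃ σ valid closing super-threshold, Nonempty …`,
  file `Summits/NavierStokesRegularity/NavierStokesRegularity/Theorems/FluidComputerGadgetOneShot.lean`).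
* `exists_ne_zero_of_noGlobalRegularSolution` — the zero datum has the zero solution, so the
  point-of-non-vanishing hypothesis is automatic.

What this means for the programme (SPEC-SHEET §4): the reduction "library ⇒ blow-up" is correct but the
structure, as typed, forces NO cascade, NO robustness and NO rate law non-vacuously — a one-level
"library" whose only admissible input is a blow-up datum satisfies it. The empirical content of the
machine paradigm therefore lives entirely in the level-by-level MEASUREMENTS of the spec sheet
(efficiency `eta`, transfer-time exponent `alpha`, leakage, robustness radius at each level of an
actual cascade), not in the existence of a term of this type; a "live" interface whose step hypothesis
quantifies over LOCAL solutions on `[t, t + T n]` (so that it can be instantiated level by level without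
presupposing blow-up) is future work and is deliberately NOT typed here.

Design: the time-shift lemmas are stated for the Clay glue predicates of `NSWave0.lean` on `ℝ³`
(`IsSmoothOnHalfSpace`, `HasBoundedEnergy`, `IsNavierStokesSolution ν 0`); the one-sided time
derivative within `[0,∞)` at `s + t₀` agrees with the one within `[t₀,∞)` because a field smooth on the
closed half-space is differentiable within `[0,∞)` there (`derivWithin_subset`). No new axioms, no sorry.
-/

open scoped ContDiff ENNReal Topology Pointwise
open Filter Set Metric MeasureTheory

namespace Literature.Analysis.FluidPDE.FluidComputer

/-- `NoGlobalRegularSolution ν v`: there is NO global regular (Clay-class) solution of Navier–Stokes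
with viscosity `ν`, zero force and datum `v` — no `u, p` smooth on `[0,∞) × ℝ³` solving the system
with bounded energy. This is the conclusion of `GadgetLibrary.no_global_regular_solution` for
`v = lib.seed`, and (for a Clay-class `v` and `ν > 0`) the negation of the instance of Clay (A) at
`(ν, v)`. [folklore] -/
def NoGlobalRegularSolution (ν : ℝ) (v : Vel) : Prop :=
  ¬ ∃ (u : ℝ → Vel) (p : ℝ → E3 → ℝ), IsSmoothOnHalfSpace u ∧ IsSmoothOnHalfSpace p ∧
      IsNavierStokesSolution ν 0 v u p ∧ HasBoundedEnergy u

/-! ## Time translation of global regular solutions -/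

/-- Smoothness on the closed half-space `[0,∞) × ℝ³` is preserved by a forward time shift
`s ↦ w (s + t₀)`, `t₀ ≥ 0`. [folklore] -/
theorem isSmoothOnHalfSpace_timeShift {F : Type*} [NormedAddCommGroup F] [NormedSpace ℝ F]
    {w : ℝ → E3 → F} (hw : IsSmoothOnHalfSpace w) {t₀ : ℝ} (ht₀ : 0 ≤ t₀) :
    IsSmoothOnHalfSpace (fun s => w (s + t₀)) := by
  have hg : ContDiff ℝ ∞ (fun q : ℝ × E3 => (q.1 + t₀, q.2)) := by fun_prop
  have hmaps : Set.MapsTo (fun q : ℝ × E3 => (q.1 + t₀, q.2))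
      (Set.Ici (0 : ℝ) ×ˢ (Set.univ : Set E3)) (Set.Ici (0 : ℝ) ×ˢ (Set.univ : Set E3)) := by
    intro q hq
    simp only [Set.mem_prod, Set.mem_Ici, Set.mem_univ, and_true] at hq ⊢
    linarith
  have h := ContDiffOn.comp hw hg.contDiffOn hmaps
  exact h

/-- Bounded energy is preserved by a forward time shift `t₀ ≥ 0`. [folklore] -/
theorem hasBoundedEnergy_timeShift {u : ℝ → Vel} (hE : HasBoundedEnergy u) {t₀ : ℝ}
    (ht₀ : 0 ≤ t₀) : HasBoundedEnergy (fun s => u (s + t₀)) := by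
  obtain ⟨C, hC, h⟩ := hE
  exact ⟨C, hC, fun t ht => h (t + t₀) (add_nonneg ht ht₀)⟩

/-- A field smooth on the closed half-space has time slices `r ↦ u r x` differentiable within
`[0,∞)` at every `y ≥ 0`. [folklore] -/
theorem differentiableWithinAt_slice {F : Type*} [NormedAddCommGroup F] [NormedSpace ℝ F]
    {u : ℝ → E3 → F} (hu : IsSmoothOnHalfSpace u) (x : E3) {y : ℝ} (hy : 0 ≤ y) :
    DifferentiableWithinAt ℝ (fun r => u r x) (Set.Ici 0) y := by
  have hd : DifferentiableOn ℝ (Function.uncurry u) (Set.Ici (0 : ℝ) ×ˢ (Set.univ : Set E3)) :=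
    hu.differentiableOn (by simp)
  have hmem : (y, x) ∈ Set.Ici (0 : ℝ) ×ˢ (Set.univ : Set E3) := ⟨hy, Set.mem_univ _⟩
  have h2 : DifferentiableWithinAt ℝ (fun r : ℝ => (r, x)) (Set.Ici 0) y := by fun_prop
  have hmaps : Set.MapsTo (fun r : ℝ => (r, x)) (Set.Ici (0 : ℝ))
      (Set.Ici (0 : ℝ) ×ˢ (Set.univ : Set E3)) := fun r hr => ⟨hr, Set.mem_univ _⟩
  exact (hd _ hmem).comp y h2 hmaps

/-- `t₀ +ᵥ [0,∞) = [t₀,∞)`. [folklore] -/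
theorem vadd_Ici_zero (t₀ : ℝ) : t₀ +ᵥ Set.Ici (0 : ℝ) = Set.Ici t₀ := by
  ext y
  simp only [Set.mem_vadd_set, Set.mem_Ici, vadd_eq_add]
  constructor
  · rintro ⟨z, hz, rfl⟩
    linarith
  · intro hy
    exact ⟨y - t₀, by linarith, by ring⟩

/-- TIME TRANSLATION of a global regular solution: if `(u, p)` is smooth on the half-space and solves
Navier–Stokes (viscosity `ν`, zero force) from `u₀`, then for every `t₀ ≥ 0` the shifted pair
`s ↦ (u (s + t₀), p (s + t₀))` solves it from the datum `u t₀`. [folklore] -/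
theorem isNavierStokesSolution_timeShift {ν : ℝ} {u₀ : Vel} {u : ℝ → Vel} {p : ℝ → E3 → ℝ}
    (hu : IsSmoothOnHalfSpace u) (hsol : IsNavierStokesSolution ν 0 u₀ u p) {t₀ : ℝ}
    (ht₀ : 0 ≤ t₀) :
    IsNavierStokesSolution ν 0 (u t₀) (fun s => u (s + t₀)) (fun s => p (s + t₀)) where
  momentum := by
    intro s hs x
    have hm := hsol.momentum (s + t₀) (add_nonneg hs ht₀) x
    have hderiv : derivWithin (fun r => u (r + t₀) x) (Set.Ici 0) s =
        derivWithin (fun r => u r x) (Set.Ici 0) (s + t₀) := by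
      have h1 := derivWithin_comp_add_const (fun r => u r x) t₀ (Set.Ici (0 : ℝ)) s
      rw [h1, vadd_Ici_zero]
      exact derivWithin_subset (Set.Ici_subset_Ici.2 ht₀)
        (uniqueDiffOn_Ici t₀ _ (by simpa using hs))
        (differentiableWithinAt_slice hu x (add_nonneg hs ht₀))
    rw [hderiv]
    simpa using hm
  divFree := fun s hs => hsol.divFree (s + t₀) (add_nonneg hs ht₀)
  initial := by simp

/-- A global regular solution from `u₀` passes through no datum without global regular solutions:
if `NoGlobalRegularSolution ν v` then `u t ≠ v` for every `t ≥ 0`. [folklore] -/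
theorem ne_of_noGlobalRegularSolution {ν : ℝ} {v u₀ : Vel} {u : ℝ → Vel} {p : ℝ → E3 → ℝ}
    (H : NoGlobalRegularSolution ν v) (hu : IsSmoothOnHalfSpace u) (hp : IsSmoothOnHalfSpace p)
    (hsol : IsNavierStokesSolution ν 0 u₀ u p) (hE : HasBoundedEnergy u) {t : ℝ} (ht : 0 ≤ t) :
    u t ≠ v := by
  intro htv
  apply H
  refine ⟨fun s => u (s + t), fun s => p (s + t), isSmoothOnHalfSpace_timeShift hu ht,
    isSmoothOnHalfSpace_timeShift hp ht, ?_, hasBoundedEnergy_timeShift hE ht⟩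
  rw [← htv]
  exact isNavierStokesSolution_timeShift hu hsol ht

/-- The zero datum has the zero global regular solution; hence a datum with NO global regular
solution is non-zero at some point. [folklore] -/
theorem exists_ne_zero_of_noGlobalRegularSolution {ν : ℝ} {v : Vel}
    (H : NoGlobalRegularSolution ν v) : ∃ x, v x ≠ 0 := by
  by_contra h
  have hv : v = fun _ => 0 := funext fun x => by by_contra hx; exact h ⟨x, hx⟩
  subst hv
  apply H
  refine ⟨fun _ _ => 0, fun _ _ => 0, ?_, ?_, ?_, ?_⟩
  · exact contDiffOn_const
  · exact contDiffOn_const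
  · exact
      { momentum := by
          intro t _ x
          simp
        divFree := by
          intro t _ x
          simp [NSWave0.divergence]
        initial := rfl }
  · exact ⟨0, by simp, fun t _ => by simp⟩

/-! ## The one-shot library -/

open Classical in
/-- The ONE-SHOT noise functional: level `0` admits exactly the datum `v` (noise `= radius`), every
other field and every higher level is outside the input class (noise `= radius + 1`). [folklore] -/
noncomputable def oneShotNoise (σ : GadgetSpec) (v : Vel) (n : ℕ) (w : Vel) : ℝ :=
  if n = 0 ∧ w = v then σ.radius else σ.radius + 1

/-- The one-shot input classes: `oneShotNoise σ v n w ≤ radius ↔ n = 0 ∧ w = v`. [folklore] -/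
theorem oneShotNoise_le_iff {σ : GadgetSpec} {v : Vel} {n : ℕ} {w : Vel} :
    oneShotNoise σ v n w ≤ σ.radius ↔ n = 0 ∧ w = v := by
  unfold oneShotNoise
  split_ifs with h
  · simp [h]
  · simp only [h, iff_false, not_le]
    exact lt_add_one _

/-- **The one-shot gadget library.** For ANY valid spec `σ` and ANY Clay-class datum `v` (smooth,
divergence free, rapidly decaying) that is non-zero at a point `x₀` and has NO global regular solution
at viscosity `ν`, a `GadgetLibrary ν σ` with seed `v`: templates `{v}` at level `0` and `∅` above,
noise `oneShotNoise` (input classes `{v}`, `∅`, `∅`, …), level energy `≡ 1`, `E0 = 1`, transfer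
times `T ≡ 0`, nest radius `‖x₀‖`, floor constant `min 1 (‖v x₀‖² / k0³)`. The step hypothesis holds
VACUOUSLY (no global regular solution passes through `v`, `ne_of_noGlobalRegularSolution`); the floor
holds at `x₀`. This is the classical twin of the one-shot degeneracy noted summit-side by seat bp3:
the interface as typed does not force a cascade. [folklore] -/
noncomputable def oneShotLibrary (ν : ℝ) {σ : GadgetSpec} (hσ : σ.Valid) {v : Vel}
    (hv₁ : ContDiff ℝ ∞ v) (hv₂ : NSWave0.IsDivFree v) (hv₃ : HasRapidSpatialDecay v)
    {x₀ : E3} (hx₀ : v x₀ ≠ 0) (H : NoGlobalRegularSolution ν v) : GadgetLibrary ν σ where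
  template n := if n = 0 then {v} else ∅
  noise := oneShotNoise σ v
  levelEnergy _ _ := 1
  T _ := 0
  T_nonneg _ := le_rfl
  T_le_Tmax n := GadgetSpec.Tmax_nonneg hσ n
  seed := v
  seed_smooth := hv₁
  seed_divFree := hv₂
  seed_decay := hv₃
  seed_noise := oneShotNoise_le_iff.2 ⟨rfl, rfl⟩
  E0 := 1
  E0_pos := one_pos
  seed_energy := le_rfl
  step := by
    intro u₀ u p hu hp hsol hE n t ht hn
    exact absurd (oneShotNoise_le_iff.1 hn).2 (ne_of_noGlobalRegularSolution H hu hp hsol hE ht)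
  R := ‖x₀‖
  cFloor := min 1 (‖v x₀‖ ^ 2 / σ.k 0 ^ 3)
  cFloor_pos := lt_min one_pos (div_pos (pow_pos (norm_pos_iff.2 hx₀) 2)
    (pow_pos (GadgetSpec.k_pos hσ 0) 3))
  floor := by
    intro n w hw
    obtain ⟨hn, hwv⟩ := oneShotNoise_le_iff.1 hw
    subst hn
    rw [hwv]
    refine ⟨x₀, le_rfl, ?_⟩
    have hk : 0 < σ.k 0 ^ 3 := pow_pos (GadgetSpec.k_pos hσ 0) 3
    calc min 1 (‖v x₀‖ ^ 2 / σ.k 0 ^ 3) * σ.k 0 ^ 3 * 1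
        ≤ ‖v x₀‖ ^ 2 / σ.k 0 ^ 3 * σ.k 0 ^ 3 * 1 := by
          gcongr
          exact min_le_right _ _
      _ = ‖v x₀‖ ^ 2 := by rw [mul_one]; exact div_mul_cancel₀ _ (ne_of_gt hk)

/-- The seed of the one-shot library is the given datum. [folklore] -/
@[simp] theorem oneShotLibrary_seed (ν : ℝ) {σ : GadgetSpec} (hσ : σ.Valid) {v : Vel}
    (hv₁ : ContDiff ℝ ∞ v) (hv₂ : NSWave0.IsDivFree v) (hv₃ : HasRapidSpatialDecay v)
    {x₀ : E3} (hx₀ : v x₀ ≠ 0) (H : NoGlobalRegularSolution ν v) :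
    (oneShotLibrary ν hσ hv₁ hv₂ hv₃ hx₀ H).seed = v := rfl

/-- The input classes of the one-shot library: `{v}` at level `0`, empty above — no cascade. [folklore] -/
theorem oneShotLibrary_inputClass (ν : ℝ) {σ : GadgetSpec} (hσ : σ.Valid) {v : Vel}
    (hv₁ : ContDiff ℝ ∞ v) (hv₂ : NSWave0.IsDivFree v) (hv₃ : HasRapidSpatialDecay v)
    {x₀ : E3} (hx₀ : v x₀ ≠ 0) (H : NoGlobalRegularSolution ν v) (n : ℕ) :
    (oneShotLibrary ν hσ hv₁ hv₂ hv₃ hx₀ H).inputClass n = if n = 0 then {v} else ∅ := by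
  ext w
  simp only [GadgetLibrary.inputClass, Set.mem_setOf_eq]
  change oneShotNoise σ v n w ≤ σ.radius ↔ _
  rw [oneShotNoise_le_iff]
  split_ifs with h
  · simp [h]
  · simp [h]

/-- Existence of a library needs only a valid spec and one Clay-class datum without global regular
solutions (the converse of `GadgetLibrary.no_global_regular_solution`, up to the closing and threshold
conditions that theorem uses). [folklore] -/
theorem nonempty_gadgetLibrary_of_noGlobalRegularSolution (ν : ℝ) {σ : GadgetSpec} (hσ : σ.Valid)
    {v : Vel} (hv₁ : ContDiff ℝ ∞ v) (hv₂ : NSWave0.IsDivFree v) (hv₃ : HasRapidSpatialDecay v)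
    (H : NoGlobalRegularSolution ν v) : Nonempty (GadgetLibrary ν σ) := by
  obtain ⟨x₀, hx₀⟩ := exists_ne_zero_of_noGlobalRegularSolution H
  exact ⟨oneShotLibrary ν hσ hv₁ hv₂ hv₃ hx₀ H⟩

/-- **ONE-SHOT DEGENERACY of the gadget interface as typed.** For a valid, closing, super-threshold
spec (`σ.Valid`, `σ.Closure`, `s⁻¹ < eta` — the hypotheses of
`GadgetLibrary.no_global_regular_solution`), a gadget library for viscosity `ν` EXISTS if and only if
some Clay-class datum has no global regular solution at viscosity `ν`. The interface therefore carries
no content beyond the failure of global regularity: it forces no cascade, no robustness and no rate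
law non-vacuously (SPEC-SHEET v0.5 §4; ASSEMBLY.md v3 §2e).
HONEST FRAMING: a calibration statement about a typed interface; NOT a claim that NS blows up. [folklore] -/
theorem nonempty_gadgetLibrary_iff {ν : ℝ} {σ : GadgetSpec} (hσ : σ.Valid) (hclos : σ.Closure)
    (hvisc : σ.s⁻¹ < σ.eta) :
    Nonempty (GadgetLibrary ν σ) ↔
      ∃ v : Vel, ContDiff ℝ ∞ v ∧ NSWave0.IsDivFree v ∧ HasRapidSpatialDecay v ∧
        NoGlobalRegularSolution ν v := by
  constructor
  · rintro ⟨lib⟩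
    exact ⟨lib.seed, lib.seed_smooth, lib.seed_divFree, lib.seed_decay,
      lib.no_global_regular_solution hσ hclos hvisc⟩
  · rintro ⟨v, hv₁, hv₂, hv₃, H⟩
    exact nonempty_gadgetLibrary_of_noGlobalRegularSolution ν hσ hv₁ hv₂ hv₃ H

end Literature.Analysis.FluidPDE.FluidComputer
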